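import Summits.BirchSwinnertonDyer.BirchSwinnertonDyer.Theorems.KolyvaginRoadThreeSchneiderTamAtThreeHeightLogNumeratorSplitSecondDigit
import HarnessLib

/-!
# The split `3`-adic height — THE SECOND-DIGIT LAW `‖ĥ₃^{split}(Q) − R‖ ≤ max(3⁻¹‖x‖⁻¹, ‖A‖⁴, 3⁻²‖T₁‖)` and
# `log₃ q_E` to its third term from the integer model (Kodaira `I_ν`, `v_L + 2 ≤ 2ν`)

HONEST FRAMING (cell `bsd-stepL`, seat `bsd-stepL-tam3-p2` g4; `--supports stmt-BirchSwinnertonDyer-19154 --as helper`):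
THEOREMS ONLY, route-free; 0 definitions, 0 named facts, 0 sorry; nothing class-wide about Schneider's conjecture; BSD
asserted nowhere. Continuation of `…SplitSecondDigit` (the four second-digit lemmas).

* `norm_padicLog_tateParam_sub_cubicMain_le_three` — for `W = ⟨a₁,…,a₆⟩`, `c₄`, `Δ = 3^νΔ'` (`3 ∤ c₄Δ'`),
  `U = Δ'c₄³ + 744·3^νΔ'²`, `N_L = U² − c₄¹² = 3^{v_L}n_L`, `3 ∤ n_L`, `1 ≤ v_L`, `v_L + 2 ≤ 2ν`, THE Tate parameter `q`:
  `‖log₃ q − ½P₃(N_L/c₄¹²)‖ ≤ 3⁻²‖N_L‖`, `P₃(t) = t − t²/2 + t³/3`.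
* `norm_heightSplitCoord_sub_secondMain_le_three` — THE SECOND-DIGIT LAW: `W/ℚ` minimal, multiplicative at `3`,
  `‖q‖ < 1`, `Q = (x, y)` rational with `‖x‖₃ > 1`, `V₀ ≠ 0` with `‖log₃ q − V₀‖ ≤ 3⁻²‖V₀‖`:
  `‖ĥ₃^{split}(Q) − (½P₃(A) + (b₂b₄/c₄)·den/num − M(z)²·(−c₆/c₄)/V₀)‖ ≤ max(3⁻¹‖x‖⁻¹, ‖A‖⁴, 3⁻²‖M(z)²(−c₆/c₄)/V₀‖)`,
  `A = (num x)² − 1`, `z = −x/y`, `M(z) = z + (a₁/2)z² + ((a₁²+a₂)/3)z³`.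

References: [SteinWuthrich2013] §4.2 (p. 16); [SilvermanAEC2009] IV.6.3–6.4, VII.2.2; [SilvermanATAEC1994] Thm. V.3.1(b),
Lemma V.5.1; [Iwasawa1972PadicL] §4.4.
-/

noncomputable section

open scoped Classical
open Filter Topology IsUltrametricDist
open WeierstrassCurve Literature.NumberTheory.EllipticCurves
open Literature.NumberTheory.EllipticCurves.SteinWuthrich2013
open Literature.NumberTheory.EllipticCurves.TateCurve
open Literature.NumberTheory.EllipticCurves.Rank1Residual
open Summit.BirchSwinnertonDyer.Uniform.UI.O2
open Summit.BirchSwinnertonDyer.Rank1Residual Summit.BirchSwinnertonDyer.Rank1Residual.X11b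

namespace Summit.BirchSwinnertonDyer.Rank1Residual.X11b.RegMult.HeightLogNumerator

/-! ### §15 `log₃ q_E` to its third term from the model, and the second-digit law -/

section SecondDigitLaw

/-- **`log₃ q_E` to its third term from the integer model** (hypotheses in the module docstring): the unit part of
`q` is `u ≡ u₁ = U/c₄⁶ (mod 3^{2ν})`, `B₁ = u₁² − 1 = N_L/c₄¹²` has `‖B₁‖ = 3^{−v_L}`, and `3^{−2ν} ≤ 3⁻²‖B₁‖`.
[cite: SilvermanATAEC1994, Thm. V.3.1(b), Lemma V.5.1] [cite: Iwasawa1972PadicL, §4.4] -/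
theorem norm_padicLog_tateParam_sub_cubicMain_le_three (W : WeierstrassCurve ℚ) {a₁ a₂ a₃ a₄ a₆ : ℤ}
    (hW : W = ⟨a₁, a₂, a₃, a₄, a₆⟩) [W.IsElliptic] {c4 Dp U NL nL : ℤ} {ν vL : ℕ}
    (hc4 : c4 = (a₁ ^ 2 + 4 * a₂) ^ 2 - 24 * (2 * a₄ + a₁ * a₃))
    (hD : (3 : ℤ) ^ ν * Dp = -(a₁ ^ 2 + 4 * a₂) ^ 2 * (a₁ ^ 2 * a₆ + 4 * a₂ * a₆ - a₁ * a₃ * a₄ + a₂ * a₃ ^ 2 - a₄ ^ 2) -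
      8 * (2 * a₄ + a₁ * a₃) ^ 3 - 27 * (a₃ ^ 2 + 4 * a₆) ^ 2 + 9 * (a₁ ^ 2 + 4 * a₂) * (2 * a₄ + a₁ * a₃) * (a₃ ^ 2 + 4 * a₆))
    (hpc4 : ¬ (3 : ℤ) ∣ c4) (hpDp : ¬ (3 : ℤ) ∣ Dp)
    (hU : U = Dp * c4 ^ 3 + 744 * (3 : ℤ) ^ ν * Dp ^ 2) (hNL : NL = U ^ 2 - c4 ^ 12)
    (hnL : NL = (3 : ℤ) ^ vL * nL) (hpnL : ¬ (3 : ℤ) ∣ nL) (hvL1 : 1 ≤ vL) (hvL : vL + 2 ≤ 2 * ν)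
    {q : ℚ_[3]} (hq0 : q ≠ 0) (hq : ‖q‖ < 1) (hj : tateJ q = (W.j : ℚ_[3])) :
    ‖padicLog 3 q - (2 : ℚ_[3])⁻¹ * (((NL : ℚ_[3]) / (c4 : ℚ_[3]) ^ 12) - ((NL : ℚ_[3]) / (c4 : ℚ_[3]) ^ 12) ^ 2 / 2 +
        ((NL : ℚ_[3]) / (c4 : ℚ_[3]) ^ 12) ^ 3 / 3)‖ ≤ 3⁻¹ ^ 2 * ‖(NL : ℚ_[3])‖ ∧
      ‖(NL : ℚ_[3]) / (c4 : ℚ_[3]) ^ 12‖ = ‖(NL : ℚ_[3])‖ ∧ ‖(NL : ℚ_[3])‖ = (3 : ℝ) ^ (-(vL : ℤ)) := by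
  have hp1 : (1 : ℝ) < ((3 : ℕ) : ℝ) := by norm_num
  have hpR : (0 : ℝ) < ((3 : ℕ) : ℝ) := by norm_num
  have hp0 : ((3 : ℕ) : ℚ_[3]) ≠ 0 := by norm_num
  have hc4n : ‖(c4 : ℚ_[3])‖ = 1 := BinaryQuartic.norm_intCast_eq_one (by exact_mod_cast hpc4)
  have hDpn : ‖(Dp : ℚ_[3])‖ = 1 := BinaryQuartic.norm_intCast_eq_one (by exact_mod_cast hpDp)
  have hc40 : (c4 : ℚ_[3]) ≠ 0 := norm_pos_iff.mp (by rw [hc4n]; exact one_pos)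
  -- `‖NL‖ = 3^{−vL}`
  have hNLn : ‖(NL : ℚ_[3])‖ = (3 : ℝ) ^ (-(vL : ℤ)) := by
    have h1 : ((3 : ℕ) : ℤ) ^ vL ∣ NL := ⟨nL, by exact_mod_cast hnL⟩
    have h2 : ¬ ((3 : ℕ) : ℤ) ^ (vL + 1) ∣ NL := by
      rintro ⟨t, ht⟩
      apply hpnL
      refine ⟨t, ?_⟩
      have hp0' : (3 : ℤ) ^ vL ≠ 0 := pow_ne_zero _ (by norm_num)
      have : (3 : ℤ) ^ vL * nL = (3 : ℤ) ^ vL * (3 * t) := by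
        rw [← hnL]; push_cast at ht; rw [ht]; ring
      exact mul_left_cancel₀ hp0' this
    have h := GaloisImage.PadicSquareClass.norm_intCast_padic_eq (p := 3) h1 h2
    exact_mod_cast h
  have hB₁n' : ‖(NL : ℚ_[3]) / (c4 : ℚ_[3]) ^ 12‖ = ‖(NL : ℚ_[3])‖ := by
    rw [norm_div, norm_pow, hc4n, one_pow, div_one]
  refine ⟨?_, hB₁n', hNLn⟩
  -- `1/j`, `‖q‖`, `ord q`
  have hD' : ((3 : ℕ) : ℤ) ^ ν * Dp = -(a₁ ^ 2 + 4 * a₂) ^ 2 * (a₁ ^ 2 * a₆ + 4 * a₂ * a₆ - a₁ * a₃ * a₄ + a₂ * a₃ ^ 2 - a₄ ^ 2) -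
      8 * (2 * a₄ + a₁ * a₃) ^ 3 - 27 * (a₃ ^ 2 + 4 * a₆) ^ 2 +
      9 * (a₁ ^ 2 + 4 * a₂) * (2 * a₄ + a₁ * a₃) * (a₃ ^ 2 + 4 * a₆) := by exact_mod_cast hD
  have hJ : (tateJ q)⁻¹ = ((3 : ℕ) : ℚ_[3]) ^ ν * (Dp : ℚ_[3]) / (c4 : ℚ_[3]) ^ 3 := by
    rw [hj, ratCast_j_inv_eq_padic (p := 3) W hW hc4 hD']; push_cast; ring
  have hpn : ‖((3 : ℕ) : ℚ_[3]) ^ ν‖ = ((3 : ℕ) : ℝ) ^ (-(ν : ℤ)) := by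
    rw [norm_pow, Padic.norm_p, ← zpow_natCast, inv_zpow']
  have hqn : ‖q‖ = ((3 : ℕ) : ℝ) ^ (-(ν : ℤ)) := by
    rw [← inv_inv ‖q‖, ← norm_tateJ_eq hq, ← norm_inv, hJ, norm_div, norm_mul, hpn, norm_pow, hc4n, hDpn,
      one_pow, div_one, mul_one]
  have hval : q.valuation = ν := by
    have h := Padic.norm_eq_zpow_neg_valuation hq0
    rw [hqn] at h
    have := zpow_right_injective₀ hpR hp1.ne' h
    omega
  set u₁ : ℚ_[3] := (U : ℚ_[3]) / (c4 : ℚ_[3]) ^ 6 with hu₁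
  have hu₁eq : ((tateJ q)⁻¹ + 744 * (tateJ q)⁻¹ ^ 2) * ((3 : ℕ) : ℚ_[3]) ^ (-q.valuation) = u₁ := by
    rw [hval, hJ, hu₁, hU, zpow_neg, zpow_natCast]
    push_cast
    field_simp
  have hu₁n : ‖u₁‖ ≤ 1 := by
    rw [hu₁, norm_div, norm_pow, hc4n, one_pow, div_one]; exact Padic.norm_int_le_one _
  have hB₁eq : u₁ ^ 2 - 1 = (NL : ℚ_[3]) / (c4 : ℚ_[3]) ^ 12 := by
    rw [hNL, hu₁]; push_cast
    rw [div_pow, ← pow_mul, sub_div, div_self (pow_ne_zero _ hc40)]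
  have hB₁n : ‖u₁ ^ 2 - 1‖ = (3 : ℝ) ^ (-(vL : ℤ)) := by rw [hB₁eq, hB₁n', hNLn]
  have hB₁0 : u₁ ^ 2 - 1 ≠ 0 := norm_pos_iff.mp (by rw [hB₁n]; positivity)
  have hB₁le : ‖u₁ ^ 2 - 1‖ ≤ 1 / 3 := by
    rw [hB₁n, show (1 / 3 : ℝ) = (3 : ℝ) ^ (-(1 : ℤ)) by norm_num]
    exact zpow_le_zpow_right₀ (by norm_num) (by omega)
  have happ : ‖q * ((3 : ℕ) : ℚ_[3]) ^ (-q.valuation) - u₁‖ ≤ 3⁻¹ ^ 2 * ‖u₁ ^ 2 - 1‖ := by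
    rw [hB₁n, ← hu₁eq]
    refine (norm_unitPart_tateParam_sub_le hq0 hq).trans ?_
    rw [hqn, ← zpow_natCast, ← zpow_mul, show ((3 : ℝ)⁻¹) ^ 2 = (3 : ℝ) ^ (-(2 : ℤ)) by norm_num, ← zpow_add₀ (by norm_num)]
    push_cast
    exact zpow_le_zpow_right₀ (by norm_num) (by omega)
  have hmain := norm_padicLog_three_sub_cubicMain_le_of_unit_approx hq0 hu₁n hB₁0 hB₁le happ
  rw [hB₁eq, hB₁n'] at hmain
  exact hmain

variable {W : WeierstrassCurve ℚ}

/-- **THE SECOND-DIGIT SPLIT LAW at `3`** (statement in the module docstring). Mechanism: `ĥ^{split} − R =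
(ĥ_{4.1} − log₃ num x − (b₂b₄/c₄)den/num) + (log₃ num x − ½P₃(A)) − (T − T₁)` with `T = log_E(z)²C⁻²/log₃ q`,
`T₁ = M(z)²(−c₆/c₄)/V₀`, each factor of `T` known to relative precision `3⁻²` (`‖log_E z − M(z)‖ ≤ 3⁻²‖z‖`,
`‖C⁻² + c₆/c₄‖ ≤ 3⁻¹‖q‖ ≤ 3⁻²`, `‖log₃ q − V₀‖ ≤ 3⁻²‖V₀‖`). [cite: SteinWuthrich2013, §4.2] [cite: Iwasawa1972PadicL, §4.4] -/
theorem norm_heightSplitCoord_sub_secondMain_le_three [W.IsElliptic] [W.IsGloballyMinimal] (hW : Mult W 3)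
    {q : ℚ_[3]} (hq : ‖q‖ < 1) {x y : ℚ} (hxy : W.toAffine.Nonsingular x y) (hx : 1 < ‖(x : ℚ_[3])‖)
    {V₀ : ℚ_[3]} (hV₀ : V₀ ≠ 0) (hV : ‖padicLog 3 q - V₀‖ ≤ 3⁻¹ ^ 2 * ‖V₀‖) :
    ‖heightSplitCoord W 3 q x y -
        ((2 : ℚ_[3])⁻¹ * ((((x.num : ℚ) : ℚ_[3]) ^ 2 - 1) - (((x.num : ℚ) : ℚ_[3]) ^ 2 - 1) ^ 2 / 2 +
            (((x.num : ℚ) : ℚ_[3]) ^ 2 - 1) ^ 3 / 3) +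
          (W.baseChange ℚ_[3]).b₂ * (W.baseChange ℚ_[3]).b₄ / (W.baseChange ℚ_[3]).c₄ *
            (((x.den : ℚ) : ℚ_[3]) / ((x.num : ℚ) : ℚ_[3])) -
          ((-(x : ℚ_[3]) / y) + (2 : ℚ_[3])⁻¹ * (W.baseChange ℚ_[3]).a₁ * (-(x : ℚ_[3]) / y) ^ 2 +
              (3 : ℚ_[3])⁻¹ * ((W.baseChange ℚ_[3]).a₁ ^ 2 + (W.baseChange ℚ_[3]).a₂) * (-(x : ℚ_[3]) / y) ^ 3) ^ 2 *
            (-((W.c₆ : ℚ_[3]) / (W.c₄ : ℚ_[3]))) / V₀)‖ ≤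
      max (3⁻¹ * ‖(x : ℚ_[3])‖⁻¹) (max (‖((x.num : ℚ) : ℚ_[3]) ^ 2 - 1‖ ^ 4)
        (3⁻¹ ^ 2 * ‖((-(x : ℚ_[3]) / y) + (2 : ℚ_[3])⁻¹ * (W.baseChange ℚ_[3]).a₁ * (-(x : ℚ_[3]) / y) ^ 2 +
              (3 : ℚ_[3])⁻¹ * ((W.baseChange ℚ_[3]).a₁ ^ 2 + (W.baseChange ℚ_[3]).a₂) * (-(x : ℚ_[3]) / y) ^ 3) ^ 2 *
            (-((W.c₆ : ℚ_[3]) / (W.c₄ : ℚ_[3]))) / V₀‖)) := by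
  -- names
  set V := W.baseChange ℚ_[3] with hVdef
  set h : ℚ_[3] := heightFourOneCoord W 3 q x y with hh
  set z : ℚ_[3] := -(x : ℚ_[3]) / y with hz
  set ℓ : ℚ_[3] := V.padicFormalLog z with hℓ
  set M : ℚ_[3] := z + (2 : ℚ_[3])⁻¹ * V.a₁ * z ^ 2 + (3 : ℚ_[3])⁻¹ * (V.a₁ ^ 2 + V.a₂) * z ^ 3 with hM
  set Cinv : ℚ_[3] := (uniformisationScaleSq W 3 q)⁻¹ with hCinv
  set L : ℚ_[3] := padicLog 3 q with hLdef
  set r46 : ℚ_[3] := (W.c₆ : ℚ_[3]) / (W.c₄ : ℚ_[3]) with hr46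
  set a3 : ℚ_[3] := ((x.num : ℚ) : ℚ_[3]) with ha3
  set P₃ : ℚ_[3] := (2 : ℚ_[3])⁻¹ * ((a3 ^ 2 - 1) - (a3 ^ 2 - 1) ^ 2 / 2 + (a3 ^ 2 - 1) ^ 3 / 3) with hP₃
  set κ : ℚ_[3] := V.b₂ * V.b₄ / V.c₄ * (((x.den : ℚ) : ℚ_[3]) / a3) with hκ
  have hr0 : (0 : ℝ) ≤ 3⁻¹ ^ 2 := by positivity
  have hr1 : (3⁻¹ : ℝ) ^ 2 < 1 := by norm_num
  -- `num x` is an integer prime to `3`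
  have hnum1 : ‖a3‖ = 1 := norm_num_eq_one_padic (p := 3) hx
  have hpa : ¬ (3 : ℤ) ∣ x.num := by
    intro hd
    have : ‖a3‖ < 1 := by rw [ha3, Rat.cast_intCast]; exact Padic.norm_intCast_lt_one_iff.mpr (by exact_mod_cast hd)
    rw [hnum1] at this; exact lt_irrefl _ this
  -- (i) the second-order law of `ĥ_{4.1}` and (ii) `log₃ num x` to its third term
  have hi := norm_heightFourOneCoord_sub_padicLog_num_sub_le hW hq hxy hx
  have hii : ‖padicLog 3 a3 - P₃‖ ≤ ‖a3 ^ 2 - 1‖ ^ 4 := by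
    rw [ha3, Rat.cast_intCast]; exact norm_padicLog_three_intCast_sub_cubicMain_le hpa
  -- (iii) the 𝓛-term to relative precision `3⁻²`
  obtain ⟨hzle, hz2⟩ := norm_neg_div_of_one_lt_norm (p := 3) hxy hx
  rw [← hz] at hzle hz2
  have hzpos : 0 < ‖z‖ := by
    have h0 : 0 < ‖z‖ ^ 2 := by rw [hz2]; exact inv_pos.mpr (one_pos.trans hx)
    rcases (norm_nonneg z).eq_or_lt with h0' | h0'
    · rw [← h0'] at h0; norm_num at h0
    · exact h0'
  obtain ⟨ha1, ha2, -⟩ := norm_baseChange_a_le_one (W := W) (p := 3)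
  rw [← hVdef] at ha1 ha2
  have hz3 : ‖z‖ ≤ 1 / 3 := by simpa using hzle
  -- `‖M‖ = ‖z‖`
  have hMz : ‖M - z‖ < ‖z‖ := by
    have e : M - z = ((2 : ℚ_[3])⁻¹ * V.a₁ * z + (3 : ℚ_[3])⁻¹ * (V.a₁ ^ 2 + V.a₂) * z ^ 2) * z := by rw [hM]; ring
    rw [e, norm_mul]
    refine mul_lt_of_lt_one_left hzpos ((norm_add_le_max _ _).trans_lt (max_lt ?_ ?_))
    · rw [norm_mul, norm_mul, norm_inv, show (2 : ℚ_[3]) = ((2 : ℕ) : ℚ_[3]) by norm_num,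
        Padic.norm_natCast_eq_one_iff.mpr (by decide), inv_one, one_mul]
      calc ‖V.a₁‖ * ‖z‖ ≤ 1 * (1 / 3) := mul_le_mul ha1 hz3 (norm_nonneg _) zero_le_one
        _ < 1 := by norm_num
    · rw [norm_mul, norm_mul, norm_inv, show (3 : ℚ_[3]) = ((3 : ℕ) : ℚ_[3]) by norm_cast, Padic.norm_p, norm_pow]
      have hA : ‖V.a₁ ^ 2 + V.a₂‖ ≤ 1 := by
        refine (norm_add_le_max _ _).trans (max_le ?_ ha2)
        rw [norm_pow]; exact pow_le_one₀ (norm_nonneg _) ha1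
      calc ((3 : ℕ) : ℝ)⁻¹⁻¹ * ‖V.a₁ ^ 2 + V.a₂‖ * ‖z‖ ^ 2 ≤ ((3 : ℕ) : ℝ)⁻¹⁻¹ * 1 * (1 / 3) ^ 2 := by gcongr
        _ < 1 := by norm_num
  have hMn : ‖M‖ = ‖z‖ := by
    have h := norm_add_eq_max_of_norm_ne_norm hMz.ne'
    rw [add_sub_cancel, max_eq_left hMz.le] at h
    exact h
  have hℓn : ‖ℓ‖ = ‖z‖ := by rw [hℓ, hz]; exact norm_padicFormalLog_param_eq (p := 3) (by norm_num) hxy hx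
  have hX : ‖ℓ ^ 2 - M ^ 2‖ ≤ 3⁻¹ ^ 2 * ‖M ^ 2‖ := by
    have hd : ‖ℓ - M‖ ≤ (3 : ℝ)⁻¹ ^ 2 * ‖z‖ := by
      rw [hℓ, hM, hz, hVdef]; exact norm_padicFormalLog_sub_cubicMain_le_three hxy hx
    have hs : ‖ℓ + M‖ ≤ ‖z‖ := (norm_add_le_max _ _).trans (max_le hℓn.le hMn.le)
    rw [show ℓ ^ 2 - M ^ 2 = (ℓ - M) * (ℓ + M) by ring, norm_mul, norm_pow, hMn]
    calc ‖ℓ - M‖ * ‖ℓ + M‖ ≤ ((3 : ℝ)⁻¹ ^ 2 * ‖z‖) * ‖z‖ := mul_le_mul hd hs (norm_nonneg _) (by positivity)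
      _ = 3⁻¹ ^ 2 * ‖z‖ ^ 2 := by ring
  have h4 : ‖(W.c₄ : ℚ_[3])‖ = 1 := norm_c₄_eq_one_of_hasMultiplicativeReductionAtPrime hW
  have h6 : ‖(W.c₆ : ℚ_[3])‖ = 1 := norm_c₆_eq_one_of_mult hW
  have hr46n : ‖-r46‖ = 1 := by rw [norm_neg, hr46, norm_div, h4, h6, div_one]
  have hq3 : ‖q‖ ≤ 3⁻¹ := by
    have hh := (Padic.norm_le_pow_iff_norm_lt_pow_add_one q (-1)).mpr (by rw [neg_add_cancel, zpow_zero]; exact hq)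
    rw [zpow_neg_one] at hh; exact_mod_cast hh
  have hY : ‖Cinv - (-r46)‖ ≤ 3⁻¹ ^ 2 * ‖-r46‖ := by
    rw [hr46n, mul_one, sub_neg_eq_add]
    refine (norm_inv_uniformisationScaleSq_add_le_three hW hq).trans ?_
    calc (3 : ℝ)⁻¹ * ‖q‖ ≤ 3⁻¹ * 3⁻¹ := mul_le_mul_of_nonneg_left hq3 (by norm_num)
      _ = 3⁻¹ ^ 2 := by ring
  have hT : ‖ℓ ^ 2 * Cinv / L - M ^ 2 * (-r46) / V₀‖ ≤ 3⁻¹ ^ 2 * ‖M ^ 2 * (-r46) / V₀‖ :=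
    norm_mul_div_sub_le_of_rel hr0 hr1 hV₀ hX hY hV
  -- the split height in these names
  have hsplit : heightSplitCoord W 3 q x y = h - ℓ ^ 2 * Cinv / L := by
    rw [heightSplitCoord_eq_sub, hh, hℓ, hz, hCinv, hLdef, hVdef]
    unfold logUnitParamSq
    rw [div_eq_mul_inv _ (uniformisationScaleSq W 3 q)]
  -- assemble
  have e : heightSplitCoord W 3 q x y - (P₃ + κ - M ^ 2 * (-r46) / V₀) =
      (h - padicLog 3 a3 - κ) + (padicLog 3 a3 - P₃) + -(ℓ ^ 2 * Cinv / L - M ^ 2 * (-r46) / V₀) := by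
    rw [hsplit]; ring
  rw [e]
  refine (norm_add_le_max _ _).trans (max_le ((norm_add_le_max _ _).trans (max_le ?_ ?_)) ?_)
  · exact hi.trans (le_max_left _ _)
  · exact hii.trans (le_max_of_le_right (le_max_left _ _))
  · rw [norm_neg]; exact hT.trans (le_max_of_le_right (le_max_right _ _))

end SecondDigitLaw

end Summit.BirchSwinnertonDyer.Rank1Residual.X11b.RegMult.HeightLogNumerator

end
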